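import Summits.NavierStokesRegularity.NavierStokesRegularity.Theorems.ScaledTopAlignmentBulkFatou
import Literature.Analysis.FluidPDE.VorticityCalculus
import HarnessLib
/-!
# Route `ScaledTopAlignment`: the WINDOW lemma for the RE-ANCHORED door W3ᵐᵗ-∃e along a zoom with rising
# levels (support for the deciding crux `AprioriMostTimesBulkAlignment`, stmt-NavierStokesRegularity-19551,
# and the planner's banked re-anchored variant W3ᵐᵗ-∃e, cell rev21/; no route-file import)

Sibling of `ScaledTopAlignmentMostTimesWindowLevels` (`dirSine_near_eq_zero_levels`,
`exists_window_cross_eq_zero_of_windowBulkAligned_levels`: the window-bulk door read along the time sequence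
of a vorticity zoom, above rising levels `M_j λ_j² → 0`, makes the limit `Ω` locally parallel to `Ω y₀`).
Tribunal T2 gen 6 (kit inspection): the door's ANCHOR `ξ(t,x) = ω(t,x)/|ω(t,x)|`, against which the misaligned
bulk is measured, is used only here, and the endgame `eq_zero_of_aligned_window` needs alignment with ANY fixed
non-zero vector on one open set. This file proves the window lemma for an ARBITRARY unit anchor field `e_j(x)`:

* `dirSine_anchor_near_eq_zero_levels` — localised Fatou upgrade with anchors: the door (ratio `λ₀ > 0`, radius
  `R₀`, one rate threshold `κ`, levels `M_j λ_j² → 0`) at the preimages `x_c^j + λ_j y₀` of a base point `y₀`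
  (`Ω y₀ ≠ 0`, `κ < |Ω y₀| σ₀`) with unit anchors `a_j → e⋆` forces the sine between `e⋆` and `Ω y` to vanish for
  `λ₀|Ω y₀| < |Ω y|`, `|y − y₀| < R₀/(2√(2|Ω y₀|))` (else a ball around `y` is `a_j`-misaligned, comparable and
  inside the window for all large `j`, and its physical volume `λ_j³|ball|` beats `δ(ν/|ω|)^{3/2} ≍ δλ_j³`);
* `exists_window_cross_anchor_eq_zero_of_anchorBulkAligned_levels` — the window lemma: with a unit anchor FIELD
  `e_j(x)` in the door along the zoom, the anchors at the preimages of `y₀` have a convergent subsequence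
  `a_{φ(j)} → e⋆` (`S²` compact), and `Ω` is parallel to `e⋆ ≠ 0` on a neighbourhood of `y₀`.

Consumed by `ScaledTopAlignmentExistsAnchorGlueKit`. WHAT THIS IS NOT: not NS regularity; nothing here proves any
door. References: Giga–Miura, CMP 303 (2011) = HUPS #956, §2.1 [GigaMiura2011]; KNSS, Acta Math. 203 (2009), §6.
-/

noncomputable section
-- the summit and its single sub-problem share the name (CONVENTIONS §1), as in every Theorems file
set_option linter.dupNamespace false
open MeasureTheory Set Function Filter Topology Metric
open scoped RealInnerProductSpace ENNReal
namespace Summit.NavierStokesRegularity.NavierStokesRegularity.Theorems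
open Literature.Analysis Literature.Analysis.FluidPDE

set_option maxHeartbeats 400000 in
/-- **Localised Fatou upgrade with anchors, rising levels.** Window-bulk alignment against unit anchors `a_j → e⋆`
(ratio `λ₀ > 0`, radius `R₀`, ONE rate threshold `κ`, levels `M_j λ_j² → 0`) at the preimages `x_c^j + λ_j y₀` of a
base point `y₀` along the times `t_j` of a vorticity zoom `(λ_j²/ν) ω(t_j, x_c^j + λ_j ·) → Ω`, `λ_j² σ₀ ≤ ν(T − t_j)`,
`Ω y₀ ≠ 0`, `κ < |Ω y₀| σ₀`, forces the sine between `e⋆` and `Ω y` to vanish for `λ₀|Ω y₀| < |Ω y|`,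
`|y − y₀| < R₀/(2√(2|Ω y₀|))` (the tree's `dirSine_near_eq_zero_levels` with `ξ(t_j,x_j) ↦ a_j`). [folklore] -/
theorem dirSine_anchor_near_eq_zero_levels {ν T : ℝ} (hν : 0 < ν)
    {ω : ℝ → EuclideanSpace ℝ (Fin 3) → EuclideanSpace ℝ (Fin 3)} {lam₀ R₀ κ σ₀ : ℝ}
    (hlam₀ : 0 < lam₀) (hR₀ : 0 < R₀) (hσ₀ : 0 < σ₀)
    {xc : ℕ → EuclideanSpace ℝ (Fin 3)} {t : ℕ → ℝ} {lam : ℕ → ℝ}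
    {Ω : EuclideanSpace ℝ (Fin 3) → EuclideanSpace ℝ (Fin 3)}
    (hlam : ∀ j, 0 < lam j) {y₀ : EuclideanSpace ℝ (Fin 3)}
    {anc : ℕ → EuclideanSpace ℝ (Fin 3)} {eStar : EuclideanSpace ℝ (Fin 3)}
    (hanc1 : ∀ j, ‖anc j‖ = 1) (hanc : Tendsto anc atTop (𝓝 eStar))
    (hW : ∀ ε : ℝ, 0 < ε → ∀ δ : ℝ, 0 < δ → ∃ Ms : ℕ → ℝ,
      Tendsto (fun j => Ms j * lam j ^ 2) atTop (𝓝 0) ∧ ∀ᶠ j in atTop,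
      Ms j ≤ ‖ω (t j) (xc j + lam j • y₀)‖ → κ / (T - t j) ≤ ‖ω (t j) (xc j + lam j • y₀)‖ →
        volume {y : EuclideanSpace ℝ (Fin 3) | lam₀ * ‖ω (t j) (xc j + lam j • y₀)‖ ≤ ‖ω (t j) y‖ ∧
            ‖(xc j + lam j • y₀) - y‖ ≤ R₀ * Real.sqrt (ν / ‖ω (t j) (xc j + lam j • y₀)‖) ∧
            ε < Real.sqrt (1 - (inner ℝ (anc j) (‖ω (t j) y‖⁻¹ • ω (t j) y)) ^ 2)}
          ≤ ENNReal.ofReal (δ * Real.sqrt (ν / ‖ω (t j) (xc j + lam j • y₀)‖) ^ 3))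
    (hpar : ∀ j, lam j ^ 2 * σ₀ ≤ ν * (T - t j)) (hΩ : Continuous Ω)
    (hconv : ∀ y, Tendsto (fun j => (lam j ^ 2 / ν) • ω (t j) (xc j + lam j • y)) atTop (𝓝 (Ω y)))
    (hy₀ : Ω y₀ ≠ 0) (hκ : κ < ‖Ω y₀‖ * σ₀) {y : EuclideanSpace ℝ (Fin 3)}
    (hyA : lam₀ * ‖Ω y₀‖ < ‖Ω y‖) (hyρ : ‖y - y₀‖ < R₀ / (2 * Real.sqrt (2 * ‖Ω y₀‖))) :
    Real.sqrt (1 - (inner ℝ eStar (‖Ω y‖⁻¹ • Ω y)) ^ 2) = 0 := by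
  -- adapted from `dirSine_near_eq_zero_levels` (`ScaledTopAlignmentMostTimesWindowLevels`): anchors `anc j`
  by_contra hs0
  set w : ℕ → EuclideanSpace ℝ (Fin 3) → EuclideanSpace ℝ (Fin 3) :=
    fun j z => (lam j ^ 2 / ν) • ω (t j) (xc j + lam j • z) with hwdef
  have hconv' : ∀ z, Tendsto (fun j => w j z) atTop (𝓝 (Ω z)) := hconv
  have heStar1 : ‖eStar‖ = 1 := by
    have h := hanc.norm
    simp_rw [hanc1] at h
    exact tendsto_nhds_unique h tendsto_const_nhds
  have heStar0 : eStar ≠ 0 := by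
    intro h; rw [h, norm_zero] at heStar1; exact zero_ne_one heStar1
  have hdirS : ‖eStar‖⁻¹ • eStar = eStar := by rw [heStar1, inv_one, one_smul]
  have hdira : ∀ j, ‖anc j‖⁻¹ • anc j = anc j := fun j => by rw [hanc1 j, inv_one, one_smul]
  set A := ‖Ω y₀‖ with hAdef
  set B := ‖Ω y‖ with hBdef
  set sn := Real.sqrt (1 - (inner ℝ eStar (‖Ω y‖⁻¹ • Ω y)) ^ 2) with hsndef
  have hA : 0 < A := norm_pos_iff.mpr hy₀
  have hB : 0 < B := lt_of_le_of_lt (by positivity) hyA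
  have hy : Ω y ≠ 0 := norm_pos_iff.mp hB
  have hsn : 0 < sn := lt_of_le_of_ne (Real.sqrt_nonneg _) (Ne.symm hs0)
  have hc : ∀ j, 0 < lam j ^ 2 / ν := fun j => div_pos (pow_pos (hlam j) 2) hν
  have hs2A : 0 < Real.sqrt (2 * A) := Real.sqrt_pos.2 (by linarith)
  set ρ : ℝ := R₀ / (2 * Real.sqrt (2 * A)) with hρ
  have hρle : ρ ≤ R₀ / Real.sqrt (2 * A) := by
    rw [hρ, div_le_div_iff_of_pos_left hR₀ (by positivity) hs2A]
    linarith
  set εS := sn / 2 with hεS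
  have hεS0 : 0 < εS := by positivity
  set θ : ℝ := max (A / 2) (κ / σ₀) with hθ
  have hθA : θ < A := max_lt (by linarith) (by rwa [div_lt_iff₀ hσ₀])
  have hθ2 : A / 2 ≤ θ := le_max_left _ _
  have hnear : ∀ᶠ y' in 𝓝 y, lam₀ * A < ‖Ω y'‖ ∧ ‖y' - y₀‖ < ρ ∧
      εS < Real.sqrt (1 - (inner ℝ eStar (‖Ω y'‖⁻¹ • Ω y')) ^ 2) := by
    have hΩy : Tendsto Ω (𝓝 y) (𝓝 (Ω y)) := (hΩ.continuousAt (x := y)).tendsto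
    have h1 : Tendsto (fun y' => ‖Ω y'‖) (𝓝 y) (𝓝 B) := hΩy.norm
    have h2 : Tendsto (fun y' => Real.sqrt (1 - (inner ℝ eStar (‖Ω y'‖⁻¹ • Ω y')) ^ 2))
        (𝓝 y) (𝓝 sn) := by
      have h := tendsto_dirSine heStar0 hy (tendsto_const_nhds (x := eStar) (f := 𝓝 y)) hΩy
      simp only [hdirS] at h
      exact h
    have h3 : Tendsto (fun y' => ‖y' - y₀‖) (𝓝 y) (𝓝 ‖y - y₀‖) :=
      ((continuous_id.sub continuous_const).norm).tendsto y
    exact (h1.eventually_const_lt hyA).and ((h3.eventually_lt_const hyρ).and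
      (h2.eventually_const_lt (by rw [hεS]; linarith)))
  obtain ⟨r, hr, hrP⟩ := Metric.eventually_nhds_iff.mp hnear
  set x₀ : ℕ → EuclideanSpace ℝ (Fin 3) := fun j => xc j + lam j • y₀ with hx₀
  set Phys : ℕ → Set (EuclideanSpace ℝ (Fin 3)) := fun j =>
    {x' : EuclideanSpace ℝ (Fin 3) | lam₀ * ‖ω (t j) (x₀ j)‖ ≤ ‖ω (t j) x'‖ ∧
      ‖x₀ j - x'‖ ≤ R₀ * Real.sqrt (ν / ‖ω (t j) (x₀ j)‖) ∧
      εS < Real.sqrt (1 - (inner ℝ (anc j) (‖ω (t j) x'‖⁻¹ • ω (t j) x')) ^ 2)} with hPhys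
  set Aset : ℕ → Set (EuclideanSpace ℝ (Fin 3)) := fun j =>
    {y' : EuclideanSpace ℝ (Fin 3) | xc j + lam j • y' ∈ Phys j} with hAset
  have e1 : ∀ᶠ j in atTop, ‖w j y₀‖ < 2 * A := (hconv' y₀).norm.eventually_lt_const (by linarith)
  have e2θ : ∀ᶠ j in atTop, θ < ‖w j y₀‖ := (hconv' y₀).norm.eventually_const_lt hθA
  have e2 : ∀ᶠ j in atTop, A / 2 < ‖w j y₀‖ := e2θ.mono fun j hj => lt_of_le_of_lt hθ2 hj
  have hmem : ∀ y' : EuclideanSpace ℝ (Fin 3), dist y' y < r → ∀ᶠ j in atTop, y' ∈ Aset j := by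
    intro y' hy'
    obtain ⟨hP1, hP2, hP3⟩ := hrP hy'
    have hΩy' : Ω y' ≠ 0 := by
      intro h; rw [h, norm_zero] at hP1; nlinarith
    have e3 : ∀ᶠ j in atTop, 0 < ‖w j y'‖ - lam₀ * ‖w j y₀‖ :=
      (((hconv' y').norm).sub (((hconv' y₀).norm).const_mul lam₀)).eventually_const_lt (by linarith)
    have e4 : ∀ᶠ j in atTop,
        εS < Real.sqrt (1 - (inner ℝ (anc j) (‖w j y'‖⁻¹ • w j y')) ^ 2) := by
      have h := tendsto_dirSine heStar0 hΩy' hanc (hconv' y')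
      simp only [hdirS, hdira] at h
      exact h.eventually_const_lt hP3
    filter_upwards [e1, e2, e3, e4] with j h1 h2 h3 h4
    set c := lam j ^ 2 / ν with hcdef
    have hcj : 0 < c := hc j
    set a := ω (t j) (x₀ j) with hadef
    set b := ω (t j) (xc j + lam j • y') with hbdef
    have hwa : w j y₀ = c • a := rfl
    have hwb : w j y' = c • b := rfl
    have hna : ‖w j y₀‖ = c * ‖a‖ := by rw [hwa, norm_smul, Real.norm_of_nonneg hcj.le]
    have hnb : ‖w j y'‖ = c * ‖b‖ := by rw [hwb, norm_smul, Real.norm_of_nonneg hcj.le]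
    show xc j + lam j • y' ∈ Phys j
    refine ⟨?_, ?_, ?_⟩
    · rw [hna, hnb] at h3
      have h8 : c * (lam₀ * ‖a‖) < c * ‖b‖ := by nlinarith [h3]
      exact (lt_of_mul_lt_mul_left h8 hcj.le).le
    · -- inside the amplitude ball of radius `R₀ √(ν/|a|)`
      have hxy : x₀ j - (xc j + lam j • y') = lam j • (y₀ - y') := by
        show (xc j + lam j • y₀) - (xc j + lam j • y') = lam j • (y₀ - y')
        rw [smul_sub]; abel
      rw [hxy, norm_smul, Real.norm_of_nonneg (hlam j).le]
      have hapos : 0 < ‖a‖ := by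
        have h0 : 0 < c * ‖a‖ := by rw [← hna]; linarith [h2]
        rcases (norm_nonneg a).lt_or_eq with hp | hz
        · exact hp
        · rw [← hz, mul_zero] at h0; exact absurd h0 (lt_irrefl 0)
      have hq : lam j ^ 2 / (2 * A) ≤ ν / ‖a‖ := by
        rw [div_le_div_iff₀ (by positivity) hapos]
        have ha2 : c * ‖a‖ < 2 * A := by rw [← hna]; exact h1
        rw [hcdef] at ha2
        have : lam j ^ 2 * ‖a‖ < 2 * A * ν := by
          have := (div_mul_eq_mul_div (lam j ^ 2) ν ‖a‖).symm ▸ ha2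
          rwa [div_lt_iff₀ hν] at this
        linarith
      have hsq : lam j / Real.sqrt (2 * A) ≤ Real.sqrt (ν / ‖a‖) := by
        have : Real.sqrt (lam j ^ 2 / (2 * A)) = lam j / Real.sqrt (2 * A) := by
          rw [Real.sqrt_div' _, Real.sqrt_sq (hlam j).le]
          positivity
        rw [← this]; exact Real.sqrt_le_sqrt hq
      have hyy : ‖y₀ - y'‖ < ρ := by rw [norm_sub_rev]; exact hP2
      calc lam j * ‖y₀ - y'‖ ≤ lam j * (R₀ / Real.sqrt (2 * A)) :=
            mul_le_mul_of_nonneg_left (hyy.le.trans hρle) (hlam j).le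
        _ = R₀ * (lam j / Real.sqrt (2 * A)) := by ring
        _ ≤ R₀ * Real.sqrt (ν / ‖a‖) := mul_le_mul_of_nonneg_left hsq hR₀.le
    · -- misaligned against the anchor `anc j` (the normalised zoom direction is the physical one)
      have hdb : ‖w j y'‖⁻¹ • w j y' = ‖b‖⁻¹ • b := by
        rw [hwb]; exact inv_norm_smul_smul_of_pos hcj b
      rw [hdb] at h4
      exact h4
  set Tail : ℕ → Set (EuclideanSpace ℝ (Fin 3)) := fun N => ⋂ j, ⋂ (_ : N ≤ j), Aset j with hTail
  have hTailmono : Monotone Tail := by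
    intro N N' hNN' z hz
    simp only [hTail, mem_iInter] at hz ⊢
    exact fun j hj => hz j (le_trans hNN' hj)
  have hball : Metric.ball y r ⊆ ⋃ N, Tail N := by
    intro y' hy'
    obtain ⟨N, hN⟩ := eventually_atTop.mp (hmem y' (Metric.mem_ball.mp hy'))
    exact mem_iUnion.mpr ⟨N, mem_iInter.mpr fun j => mem_iInter.mpr fun hj => hN j hj⟩
  set V := volume (Metric.ball y r) with hV
  have hVpos : 0 < V := Metric.measure_ball_pos volume y hr
  have hVtop : V ≠ ⊤ := (measure_ball_lt_top).ne
  have hVreal : 0 < V.toReal := ENNReal.toReal_pos hVpos.ne' hVtop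
  set K := Real.sqrt (2 / A) with hK
  have hKpos : 0 < K := Real.sqrt_pos.mpr (by positivity)
  set δ := V.toReal / (2 * K ^ 3) with hδ
  have hδ0 : 0 < δ := by positivity
  obtain ⟨Ms, hMs0, hM⟩ := hW εS hεS0 δ hδ0
  have e5 : ∀ᶠ j in atTop, Ms j * lam j ^ 2 < A * ν / 2 := hMs0.eventually_lt_const (by positivity)
  obtain ⟨N₀, hN₀⟩ := eventually_atTop.mp ((e1.and e2θ).and (e5.and hM))
  have hAj : ∀ j, N₀ ≤ j → volume (Aset j) ≤ ENNReal.ofReal (V.toReal / 2) := by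
    intro j hj
    obtain ⟨⟨h1, h2θ⟩, h5, hMj⟩ := hN₀ j hj
    have h2 : A / 2 < ‖w j y₀‖ := lt_of_le_of_lt hθ2 h2θ
    set c := lam j ^ 2 / ν with hcdef
    have hcj : 0 < c := hc j
    set a := ω (t j) (x₀ j) with hadef
    have hna : ‖w j y₀‖ = c * ‖a‖ := by
      show ‖(lam j ^ 2 / ν) • ω (t j) (xc j + lam j • y₀)‖ = c * ‖a‖
      rw [norm_smul, Real.norm_of_nonneg hcj.le]
    rw [hna] at h1 h2 h2θ
    have hl2σ : 0 < lam j ^ 2 * σ₀ := mul_pos (pow_pos (hlam j) 2) hσ₀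
    have hTt : 0 < T - t j := by
      have h : ν * 0 < ν * (T - t j) := by rw [mul_zero]; exact lt_of_lt_of_le hl2σ (hpar j)
      exact lt_of_mul_lt_mul_left h hν.le
    have hapos : 0 < ‖a‖ := by
      by_contra hle
      have ha0 : ‖a‖ = 0 := le_antisymm (not_lt.1 hle) (norm_nonneg _)
      rw [ha0, mul_zero] at h2
      linarith
    have hMa : Ms j ≤ ‖a‖ := by
      have hl2 : 0 < lam j ^ 2 := pow_pos (hlam j) 2
      have h2' : A * ν / 2 < ‖a‖ * lam j ^ 2 := by
        have h := h2
        rw [hcdef, div_mul_eq_mul_div, lt_div_iff₀ hν] at h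
        linarith
      exact (lt_of_mul_lt_mul_right (h5.trans h2') hl2.le).le
    have hκa : κ / (T - t j) ≤ ‖a‖ := by
      rw [div_le_iff₀ hTt]
      -- `‖a‖ (T - t_j) ≥ ‖a‖ λ_j² σ₀/ν = c ‖a‖ σ₀ > θ σ₀ ≥ κ`
      have hθκ : κ ≤ θ * σ₀ := by
        have : κ / σ₀ ≤ θ := le_max_right _ _
        rwa [div_le_iff₀ hσ₀] at this
      have h1' : ‖a‖ * (lam j ^ 2 * σ₀ / ν) ≤ ‖a‖ * (T - t j) := by
        refine mul_le_mul_of_nonneg_left ?_ hapos.le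
        rw [div_le_iff₀ hν]; linarith [hpar j]
      have h2' : θ * σ₀ < c * ‖a‖ * σ₀ := mul_lt_mul_of_pos_right h2θ hσ₀
      have e : ‖a‖ * (lam j ^ 2 * σ₀ / ν) = c * ‖a‖ * σ₀ := by rw [hcdef]; ring
      rw [e] at h1'
      linarith
    have hphys : volume (Phys j) ≤ ENNReal.ofReal (δ * Real.sqrt (ν / ‖a‖) ^ 3) := hMj hMa hκa
    have hpre : Aset j = (fun y' : EuclideanSpace ℝ (Fin 3) => lam j • y') ⁻¹'
        ((fun z : EuclideanSpace ℝ (Fin 3) => xc j + z) ⁻¹' Phys j) := rfl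
    have hvolA : volume (Aset j) = ENNReal.ofReal ((lam j ^ 3)⁻¹) * volume (Phys j) := by
      rw [hpre, Measure.addHaar_preimage_smul volume (hlam j).ne', finrank_euclideanSpace_fin,
        measure_preimage_add, abs_of_pos (inv_pos.mpr (pow_pos (hlam j) 3))]
    have hsqrt : Real.sqrt (ν / ‖a‖) < lam j * K := by
      have hq : ν / ‖a‖ < lam j ^ 2 * (2 / A) := by
        rw [div_lt_iff₀ hapos]
        have h6' : A / 2 < lam j ^ 2 / ν * ‖a‖ := h2
        rw [div_mul_eq_mul_div, lt_div_iff₀ hν] at h6'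
        have hA' : 0 < 2 / A := by positivity
        have h7 := mul_lt_mul_of_pos_left h6' hA'
        have h8 : 2 / A * (A / 2 * ν) = ν := by field_simp
        rw [h8] at h7
        calc ν < 2 / A * (lam j ^ 2 * ‖a‖) := h7
          _ = lam j ^ 2 * (2 / A) * ‖a‖ := by ring
      calc Real.sqrt (ν / ‖a‖) < Real.sqrt (lam j ^ 2 * (2 / A)) := Real.sqrt_lt_sqrt (by positivity) hq
        _ = lam j * K := by rw [Real.sqrt_mul (sq_nonneg (lam j)) (2 / A), Real.sqrt_sq (hlam j).le]
    calc volume (Aset j) = ENNReal.ofReal ((lam j ^ 3)⁻¹) * volume (Phys j) := hvolA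
      _ ≤ ENNReal.ofReal ((lam j ^ 3)⁻¹) * ENNReal.ofReal (δ * Real.sqrt (ν / ‖a‖) ^ 3) := by gcongr
      _ = ENNReal.ofReal ((lam j ^ 3)⁻¹ * (δ * Real.sqrt (ν / ‖a‖) ^ 3)) :=
          (ENNReal.ofReal_mul (inv_nonneg.mpr (pow_nonneg (hlam j).le 3))).symm
      _ ≤ ENNReal.ofReal (V.toReal / 2) := by
          apply ENNReal.ofReal_le_ofReal
          have hl3 : 0 < lam j ^ 3 := pow_pos (hlam j) 3
          have hineq : Real.sqrt (ν / ‖a‖) ^ 3 ≤ (lam j * K) ^ 3 :=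
            pow_le_pow_left₀ (Real.sqrt_nonneg _) hsqrt.le 3
          calc (lam j ^ 3)⁻¹ * (δ * Real.sqrt (ν / ‖a‖) ^ 3)
              ≤ (lam j ^ 3)⁻¹ * (δ * (lam j * K) ^ 3) := by
                apply mul_le_mul_of_nonneg_left _ (inv_nonneg.mpr hl3.le)
                exact mul_le_mul_of_nonneg_left hineq hδ0.le
            _ = δ * K ^ 3 := by
                have hl0 : lam j ≠ 0 := (hlam j).ne'
                field_simp
            _ = V.toReal / 2 := by
                have hK0 : K ≠ 0 := hKpos.ne'
                rw [hδ]; field_simp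
  have hTailN : ∀ N, volume (Tail N) ≤ ENNReal.ofReal (V.toReal / 2) := by
    intro N
    have hsub : Tail N ⊆ Aset (max N N₀) := by
      intro z hz
      simp only [hTail, mem_iInter] at hz
      exact hz (max N N₀) (le_max_left _ _)
    exact (measure_mono hsub).trans (hAj _ (le_max_right _ _))
  have hU : volume (⋃ N, Tail N) = ⨆ N, volume (Tail N) := hTailmono.measure_iUnion
  have hle : V ≤ ENNReal.ofReal (V.toReal / 2) :=
    calc V ≤ volume (⋃ N, Tail N) := measure_mono hball
      _ = ⨆ N, volume (Tail N) := hU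
      _ ≤ ENNReal.ofReal (V.toReal / 2) := iSup_le hTailN
  have hlt : ENNReal.ofReal (V.toReal / 2) < V := by
    calc ENNReal.ofReal (V.toReal / 2) < ENNReal.ofReal V.toReal :=
          (ENNReal.ofReal_lt_ofReal_iff_of_nonneg (by positivity)).mpr (by linarith)
      _ = V := ENNReal.ofReal_toReal hVtop
  exact absurd hle (not_le.mpr hlt)

/-- **Window lemma with an anchor field, rising levels.** Window-bulk alignment with ratio `lam0 < 1` (normalised
to `max lam0 ½`), radius `R0 > 0`, ONE rate threshold `κ`, measured against an arbitrary UNIT ANCHOR FIELD `e_j(x)`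
(instead of `ξ(t_j, x)`), above levels `M_j λ_j² → 0`, along the times of a vorticity zoom with `λ_j² σ₀ ≤ ν(T − t_j)`
and continuous limit `Ω`, makes `Ω` parallel to a FIXED `e⋆ ≠ 0` near any `y₀` with `Ω y₀ ≠ 0`, `κ < |Ω y₀| σ₀`:
the anchors at the preimages of `y₀` subconverge on the unit sphere, `dirSine_anchor_near_eq_zero_levels` runs
along the subsequence, and a vanishing sine against a unit vector is equality in Cauchy–Schwarz. [folklore] -/
theorem exists_window_cross_anchor_eq_zero_of_anchorBulkAligned_levels {ν T : ℝ} (hν : 0 < ν)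
    {ω : ℝ → EuclideanSpace ℝ (Fin 3) → EuclideanSpace ℝ (Fin 3)} {lam0 R0 κ σ₀ : ℝ}
    (hlam01 : lam0 < 1) (hR0 : 0 < R0) (hσ₀ : 0 < σ₀)
    {xc : ℕ → EuclideanSpace ℝ (Fin 3)} {t : ℕ → ℝ} {lam : ℕ → ℝ}
    {Ω : EuclideanSpace ℝ (Fin 3) → EuclideanSpace ℝ (Fin 3)}
    (hlam : ∀ j, 0 < lam j)
    {e : ℕ → EuclideanSpace ℝ (Fin 3) → EuclideanSpace ℝ (Fin 3)} (he1 : ∀ j x, ‖e j x‖ = 1)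
    (hW : ∀ ε : ℝ, 0 < ε → ∀ δ : ℝ, 0 < δ → ∃ Ms : ℕ → ℝ,
      Tendsto (fun j => Ms j * lam j ^ 2) atTop (𝓝 0) ∧ ∀ᶠ j in atTop, ∀ x : EuclideanSpace ℝ (Fin 3),
      Ms j ≤ ‖ω (t j) x‖ → κ / (T - t j) ≤ ‖ω (t j) x‖ →
        volume {y : EuclideanSpace ℝ (Fin 3) | lam0 * ‖ω (t j) x‖ ≤ ‖ω (t j) y‖ ∧
            ‖x - y‖ ≤ R0 * Real.sqrt (ν / ‖ω (t j) x‖) ∧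
            ε < Real.sqrt (1 - (inner ℝ (e j x) (‖ω (t j) y‖⁻¹ • ω (t j) y)) ^ 2)}
          ≤ ENNReal.ofReal (δ * Real.sqrt (ν / ‖ω (t j) x‖) ^ 3))
    (hpar : ∀ j, lam j ^ 2 * σ₀ ≤ ν * (T - t j)) (hΩ : Continuous Ω)
    (hconv : ∀ y, Tendsto (fun j => (lam j ^ 2 / ν) • ω (t j) (xc j + lam j • y)) atTop (𝓝 (Ω y)))
    {y₀ : EuclideanSpace ℝ (Fin 3)} (hy₀ : Ω y₀ ≠ 0) (hκ : κ < ‖Ω y₀‖ * σ₀) :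
    ∃ eStar : EuclideanSpace ℝ (Fin 3), eStar ≠ 0 ∧ ∃ U : Set (EuclideanSpace ℝ (Fin 3)),
      IsOpen U ∧ y₀ ∈ U ∧ ∀ y ∈ U, cross (Ω y) eStar = 0 := by
  set lam₀ : ℝ := max lam0 (1 / 2) with hlam₀def
  have hlam₀ : 0 < lam₀ := lt_of_lt_of_le (by norm_num) (le_max_right _ _)
  have hlam₀1 : lam₀ < 1 := max_lt hlam01 (by norm_num)
  -- the anchors at the preimages of `y₀` and a convergent subsequence on the unit sphere
  set anc : ℕ → EuclideanSpace ℝ (Fin 3) := fun j => e j (xc j + lam j • y₀) with hancdef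
  have hsph : ∀ j, anc j ∈ Metric.sphere (0 : EuclideanSpace ℝ (Fin 3)) 1 := fun j =>
    mem_sphere_zero_iff_norm.mpr (he1 j _)
  obtain ⟨eStar, heS, φ, hφ, hancφ⟩ := (isCompact_sphere (0 : EuclideanSpace ℝ (Fin 3)) 1).tendsto_subseq hsph
  have heStar1 : ‖eStar‖ = 1 := mem_sphere_zero_iff_norm.mp heS
  have heStar0 : eStar ≠ 0 := by
    intro h; rw [h, norm_zero] at heStar1; exact zero_ne_one heStar1
  -- the door along the subsequence, at the preimages of `y₀`, with ratio `lam₀`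
  have hW' : ∀ ε : ℝ, 0 < ε → ∀ δ : ℝ, 0 < δ → ∃ Ms : ℕ → ℝ,
      Tendsto (fun j => Ms j * (lam (φ j)) ^ 2) atTop (𝓝 0) ∧ ∀ᶠ j in atTop,
      Ms j ≤ ‖ω (t (φ j)) (xc (φ j) + lam (φ j) • y₀)‖ →
      κ / (T - t (φ j)) ≤ ‖ω (t (φ j)) (xc (φ j) + lam (φ j) • y₀)‖ →
        volume {y : EuclideanSpace ℝ (Fin 3) |
            lam₀ * ‖ω (t (φ j)) (xc (φ j) + lam (φ j) • y₀)‖ ≤ ‖ω (t (φ j)) y‖ ∧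
            ‖(xc (φ j) + lam (φ j) • y₀) - y‖ ≤
              R0 * Real.sqrt (ν / ‖ω (t (φ j)) (xc (φ j) + lam (φ j) • y₀)‖) ∧
            ε < Real.sqrt (1 - (inner ℝ (anc (φ j)) (‖ω (t (φ j)) y‖⁻¹ • ω (t (φ j)) y)) ^ 2)}
          ≤ ENNReal.ofReal (δ * Real.sqrt (ν / ‖ω (t (φ j)) (xc (φ j) + lam (φ j) • y₀)‖) ^ 3) := by
    intro ε hε δ hδ
    obtain ⟨Ms, hMs0, hM⟩ := hW ε hε δ hδ
    refine ⟨fun j => Ms (φ j), hMs0.comp hφ.tendsto_atTop, ?_⟩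
    filter_upwards [hφ.tendsto_atTop.eventually hM] with j hj hMx hκx
    refine le_trans (measure_mono fun y hy => ?_) (hj _ hMx hκx)
    obtain ⟨h1, h2, h3⟩ := hy
    exact ⟨le_trans (mul_le_mul_of_nonneg_right (le_max_left _ _) (norm_nonneg _)) h1, h2, h3⟩
  set A := ‖Ω y₀‖ with hAdef
  have hA : 0 < A := norm_pos_iff.mpr hy₀
  set ρ : ℝ := R0 / (2 * Real.sqrt (2 * A)) with hρ
  have hρ0 : 0 < ρ := by
    have := Real.sqrt_pos.2 (show (0 : ℝ) < 2 * A by linarith); positivity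
  refine ⟨eStar, heStar0, {y | lam₀ * A < ‖Ω y‖} ∩ ball y₀ ρ,
    (isOpen_lt continuous_const (continuous_norm.comp hΩ)).inter isOpen_ball,
    ⟨by show lam₀ * A < ‖Ω y₀‖; rw [← hAdef]; nlinarith, mem_ball_self hρ0⟩, fun y hy => ?_⟩
  obtain ⟨hyA, hyball⟩ := hy
  change lam₀ * A < ‖Ω y‖ at hyA
  rw [mem_ball, dist_eq_norm] at hyball
  have hyne : Ω y ≠ 0 := norm_pos_iff.mp (lt_of_le_of_lt (by positivity) hyA)
  have hsine := dirSine_anchor_near_eq_zero_levels (T := T) hν hlam₀ hR0 hσ₀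
    (xc := fun j => xc (φ j)) (t := fun j => t (φ j)) (lam := fun j => lam (φ j))
    (fun j => hlam (φ j)) (anc := fun j => anc (φ j)) (fun j => he1 _ _) hancφ hW'
    (fun j => hpar (φ j)) hΩ (fun y' => (hconv y').comp hφ.tendsto_atTop) hy₀ hκ hyA hyball
  -- a vanishing sine against the unit vector `e⋆` is equality in Cauchy–Schwarz: `e⋆ ∥ Ω y`
  set b := Ω y with hbdef
  have hnb : ‖b‖ ≠ 0 := norm_ne_zero_iff.mpr hyne
  set cc : ℝ := inner ℝ eStar (‖b‖⁻¹ • b) with hcc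
  have hc1 : 1 ≤ cc ^ 2 := by
    have := Real.sqrt_eq_zero'.mp hsine
    linarith
  have hcval : cc = ‖b‖⁻¹ * inner ℝ eStar b := by
    rw [hcc, real_inner_smul_right]
  have hCS : (inner ℝ eStar b) ^ 2 ≤ ‖b‖ ^ 2 := by
    have h1 := abs_real_inner_le_norm eStar b
    rw [heStar1, one_mul] at h1
    calc (inner ℝ eStar b) ^ 2 = |inner ℝ eStar b| ^ 2 := by rw [sq_abs]
      _ ≤ ‖b‖ ^ 2 := by nlinarith [h1, abs_nonneg (inner ℝ eStar b)]
  have hge : ‖b‖ ^ 2 ≤ (inner ℝ eStar b) ^ 2 := by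
    rw [hcval] at hc1
    have hpos : 0 < ‖b‖ ^ 2 := by positivity
    have hrew : (‖b‖⁻¹ * inner ℝ eStar b) ^ 2 = (inner ℝ eStar b) ^ 2 / ‖b‖ ^ 2 := by
      field_simp
    rw [hrew, le_div_iff₀ hpos] at hc1
    linarith
  have heq : (inner ℝ eStar b) ^ 2 = ‖b‖ ^ 2 := le_antisymm hCS hge
  have hr : eStar = (inner ℝ eStar b / ‖b‖ ^ 2) • b := by
    have hb2 : ‖b‖ ^ 2 ≠ 0 := pow_ne_zero 2 hnb
    have h0 : ‖eStar - (inner ℝ eStar b / ‖b‖ ^ 2) • b‖ ^ 2 = 0 := by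
      rw [norm_sub_sq_real, inner_smul_right, norm_smul, mul_pow, Real.norm_eq_abs, sq_abs, heStar1]
      field_simp
      linear_combination (-1 : ℝ) * heq
    rw [sq_eq_zero_iff, norm_eq_zero, sub_eq_zero] at h0
    exact h0
  rw [hr]
  ext i
  fin_cases i <;> simp [cross]

end Summit.NavierStokesRegularity.NavierStokesRegularity.Theorems
end
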